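import Summits.BirchSwinnertonDyer.BirchSwinnertonDyer.Theorems.Rank2ObservatoryTateDeepEngine
import Literature.NumberTheory.EllipticCurves.NeronComponentIndexTypeIVProofs
import Literature.NumberTheory.EllipticCurves.NeronComponentIndexTypeIVstarProofs
import Literature.RingTheory.DiscreteValuationRing.AdicCompletionHensel
import HarnessLib

/-!
# BSD rank ≥ 2 observatory (`b2b-bsdr2`, cert-2 gen 10): EXACT local Tamagawa numbers for the
# Kodaira types `IV` and `IV*` — part 1/2: the local theorems over a discrete valuation ring

HONEST FRAMING: per-curve certified theorems and census instruments; no claim on BSD in rank ≥ 2.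

Theorems only (no named fact, no axiom).  For a Weierstrass equation `J` over a discrete valuation
ring `R` (fraction field `K`, uniformizer `π`) in the normal form of Tate's Step 5 — `π ∣ a₁, a₂, a₃`,
`π² ∣ a₄, a₆`, `π³ ∤ b₆` (Kodaira type `IV` when the equation is minimal) — resp. of Step 8 —
`π ∣ a₁`, `π² ∣ a₂, a₃`, `π³ ∣ a₄`, `π⁴ ∣ a₆`, Step-8 quadratic separable (type `IV*`) — the tree
proves `[E(K) : E₀(K)] ∈ {1, 3}` (`LocalIndex.index_mem_of_normalForm_IV` / `…_IVstar`, Silverman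
*ATAEC* IV.9.4).  Tate's algorithm says WHICH: `3` if the quadratic `Y² + γ̄ Y − ε̄` (`a₃ = π γ`,
`a₆ = π² ε`, resp. `a₃ = π² γ`, `a₆ = π⁴ ε`) has its (two, distinct) roots in the residue field `k`,
`1` if not.  This file proves both directions:
* `index_eq_one_of_IV_no_root` / `index_eq_one_of_IVstar_no_root`: if the quadratic has no root in
  `k`, every `K`-point has nonsingular reduction — by the tree's description of the bad points
  (`LocalIndex.exists_eq_some_of_not_hasNonsingularReduction_IV/IVstar`: a bad point is
  `(π x₁, π y₁)` resp. `(π² x₂, π² y₂)` with `ȳ` a root) — so the index is `1`;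
* `index_eq_three_of_IV_root` / `index_eq_three_of_IVstar_root` (`R` Henselian): an approximate root
  `y₀` (`y₀² + γ y₀ − ε ∈ 𝔪`) with `γ² + 4ε ∉ 𝔪` has unit derivative `2y₀ + γ`, so Hensel's lemma
  (`HenselianLocalRing.exists_isRoot_of_isUnit_derivative`, tree) lifts it to `y ∈ R` with
  `y² + γ y = ε`; then `(0, π y)` resp. `(0, π² y)` is a `K`-point of `E` reducing to the singular point
  `(0, 0)` (`LocalIndex.not_hasNonsingularReduction_some`), so `E₀(K) ≠ E(K)`, the index is not `1`,
  hence it is `3`;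
* `index_IV_intCast_eq_one/three`, `index_IVstar_intCast_eq_one/three`: the same read on an INTEGER
  equation `M` cast into `R` along a presentation `p = ϖ ε` (`ε ∈ Rˣ`, the cell's
  `Rank2ObservatoryTateDeepEngine` dictionary `uniformizer_pow_dvd_intCast`, `residue_intCast_ne_zero`),
  with the root given as an integer `m` (`p ∣ m² + (a₃/pʲ) m − a₆/p²ʲ`) and "no root" as a hypothesis on
  the integer congruence for every residue class represented by an integer (the residue field of `ℤ_p`
  is `ℤ/p`; part 2 discharges this at the places of `ℚ`).
Part 2 (`Rank2ObservatoryTamagawaExactCert`) turns these into kernel certificates `c_p = 1 / 3` for the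
cell's rank-3 Tamagawa census (`Rank2ObservatoryRank3TamagawaCensus`: `IV`, `IV*` were certified only as
`c_p ∈ {1, 3}` there).
References: J. Tate, *Algorithm for determining the type of a singular fiber in an elliptic pencil*,
Modular Functions of One Variable IV, LNM 476 (1975), §§7–8 [Tate1975]; J. H. Silverman, *Advanced
Topics in the Arithmetic of Elliptic Curves*, GTM 151 (1994), IV.9.4 Steps 5 and 8 [Silverman1994]
[SilvermanATAEC1994]; J. W. S. Cassels, *Local Fields* (1986), Ch. 4 Lemma 3.1 (Hensel) [Cassels1986].
-/

set_option linter.dupNamespace false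
set_option autoImplicit false

noncomputable section

open scoped Classical

open Polynomial IsLocalRing WeierstrassCurve
  Literature.NumberTheory.EllipticCurves Literature.NumberTheory.EllipticCurves.LocalIndex
  Literature.NumberTheory.DiophantineGeometry Literature.NumberTheory.DiophantineGeometry.TateAlgorithm

namespace Summit.BirchSwinnertonDyer.BirchSwinnertonDyer.Rank2Observatory.Tam

section Local

variable {R : Type*} [CommRing R] [IsDomain R] [IsDiscreteValuationRing R]
  {K : Type*} [Field K] [Algebra R K] [IsFractionRing R K]

/-! ### Hensel: a simple approximate root of `Y² + γ Y − ε` lifts -/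

/-- Over a Henselian local ring, an approximate root `y₀` of `Y² + γY − ε` (`y₀² + γy₀ − ε ∈ 𝔪`) with
`γ² + 4ε ∉ 𝔪` lifts to a root: `(2y₀ + γ)² = (γ² + 4ε) + 4 (y₀² + γ y₀ − ε)` is a unit.
[cite: Cassels1986, Ch. 4 Lemma 3.1] -/
theorem exists_root_quadratic_of_henselian {S : Type*} [CommRing S] [HenselianLocalRing S]
    {γ ε y₀ : S} (hdisc : γ ^ 2 + 4 * ε ∉ maximalIdeal S)
    (hy₀ : y₀ ^ 2 + γ * y₀ - ε ∈ maximalIdeal S) : ∃ y : S, y ^ 2 + γ * y - ε = 0 := by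
  set g : S[X] := X ^ 2 + C γ * X - C ε with hg
  have hev : ∀ t, g.eval t = t ^ 2 + γ * t - ε := by
    intro t; simp only [hg, eval_add, eval_sub, eval_mul, eval_C, eval_pow, eval_X]
  have hev' : ∀ t, g.derivative.eval t = 2 * t + γ := by
    intro t; simp [hg]; ring
  have h₁ : g.eval y₀ ∈ maximalIdeal S := by rw [hev]; exact hy₀
  have h₂ : IsUnit (g.derivative.eval y₀) := by
    rw [hev']
    refine IsLocalRing.notMem_maximalIdeal.mp fun hm => hdisc ?_
    have e : γ ^ 2 + 4 * ε = (2 * y₀ + γ) * (2 * y₀ + γ) - 4 * (y₀ ^ 2 + γ * y₀ - ε) := by ring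
    rw [e]
    exact Ideal.sub_mem _ (Ideal.mul_mem_left _ _ hm) (Ideal.mul_mem_left _ _ hy₀)
  obtain ⟨y, hy, -⟩ := HenselianLocalRing.exists_isRoot_of_isUnit_derivative g y₀ h₁ h₂
  exact ⟨y, by rw [← hev]; exact hy⟩

/-! ### Type `IV`: the index is `1` without a residue root, `3` with one -/

/-- **Type `IV`, no root ⟹ `[E(K) : E₀(K)] = 1`**: in the normal form `a₁ = πα`, `a₂ = πβ`, `a₃ = πγ`,
`a₄ = π²δ`, `a₆ = π²ε`, a point with singular reduction is `(πx₁, πy₁)` with `ȳ₁² + γ̄ȳ₁ − ε̄ = 0`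
(tree, `exists_eq_some_of_not_hasNonsingularReduction_IV`); if the quadratic has no root in the
residue field there is none, and `E₀(K) = E(K)`. [cite: Silverman1994, IV.9.4 Step 5] -/
theorem index_eq_one_of_IV_no_root (J : WeierstrassCurve R) {ϖ α β γ δ ε : R}
    (hϖ : Irreducible ϖ) (hα : J.a₁ = ϖ * α) (hβ : J.a₂ = ϖ * β) (hγ : J.a₃ = ϖ * γ)
    (hδ : J.a₄ = ϖ ^ 2 * δ) (hε : J.a₆ = ϖ ^ 2 * ε)
    (hno : ∀ y : ResidueField R, y ^ 2 + residue R γ * y - residue R ε ≠ 0) :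
    (J.nonsingularReductionSubgroup (integers_valuationRing_valuation R K)).index = 1 := by
  have hres0 : residue R ϖ = 0 :=
    (residue_eq_zero_iff _).mpr ((IsLocalRing.mem_maximalIdeal _).mpr hϖ.not_isUnit)
  rw [AddSubgroup.index_eq_one, eq_top_iff]
  intro P _
  refine (WeierstrassCurve.mem_nonsingularReductionSubgroup_iff _).mpr (not_not.mp fun hP => ?_)
  obtain ⟨x₁, y₁, h, -, hid⟩ :=
    exists_eq_some_of_not_hasNonsingularReduction_IV J hϖ hα hβ hγ hδ hε hP
  have := congrArg (residue R) hid
  exact hno (residue R y₁) (by simpa [hres0] using this)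

/-- The memberships of the `IV` normal form from the factorisations, and `π³ ∤ b₆` from
`γ² + 4ε ∉ 𝔪` (`b₆ = a₃² + 4a₆ = π² (γ² + 4ε)`). [folklore] -/
theorem normalForm_IV_mem (J : WeierstrassCurve R) {ϖ α β γ δ ε : R}
    (hϖ : Irreducible ϖ) (hα : J.a₁ = ϖ * α) (hβ : J.a₂ = ϖ * β) (hγ : J.a₃ = ϖ * γ)
    (hδ : J.a₄ = ϖ ^ 2 * δ) (hε : J.a₆ = ϖ ^ 2 * ε) (hdisc : γ ^ 2 + 4 * ε ∉ maximalIdeal R) :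
    J.a₁ ∈ maximalIdeal R ∧ J.a₂ ∈ maximalIdeal R ∧ J.a₃ ∈ maximalIdeal R ∧
      J.a₄ ∈ maximalIdeal R ^ 2 ∧ J.a₆ ∈ maximalIdeal R ^ 2 ∧ J.b₆ ∉ maximalIdeal R ^ 3 := by
  have hm : ϖ ∈ maximalIdeal R := (IsLocalRing.mem_maximalIdeal _).mpr hϖ.not_isUnit
  have hmax : maximalIdeal R = Ideal.span {ϖ} := (IsDiscreteValuationRing.irreducible_iff_uniformizer _).mp hϖ
  have hm2 : ϖ ^ 2 ∈ maximalIdeal R ^ 2 := Ideal.pow_mem_pow hm 2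
  refine ⟨hα ▸ Ideal.mul_mem_right _ _ hm, hβ ▸ Ideal.mul_mem_right _ _ hm,
    hγ ▸ Ideal.mul_mem_right _ _ hm, hδ ▸ Ideal.mul_mem_right _ _ hm2,
    hε ▸ Ideal.mul_mem_right _ _ hm2, fun hb => hdisc ?_⟩
  rw [hmax, Ideal.span_singleton_pow, Ideal.mem_span_singleton] at hb
  obtain ⟨c, hc⟩ := hb
  rw [hmax, Ideal.mem_span_singleton]
  refine ⟨c, mul_left_cancel₀ (pow_ne_zero 2 hϖ.ne_zero) ?_⟩
  have e : J.b₆ = ϖ ^ 2 * (γ ^ 2 + 4 * ε) := by rw [WeierstrassCurve.b₆, hγ, hε]; ring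
  rw [← e, hc]; ring

/-- **Type `IV`, a root ⟹ `[E(K) : E₀(K)] = 3`** (`R` Henselian, e.g. complete): with
`γ² + 4ε ∉ 𝔪` an approximate root `y₀` of `Y² + γY − ε` lifts (Hensel) to `y` with `y² + γy = ε`;
the `K`-point `(0, πy)` of `E` (`Δ ≠ 0`: every point of the curve is nonsingular) reduces to the
singular point `(0,0)`, so it is not in `E₀(K)` and the index is not `1`; by the tree's dichotomy
`index_mem_of_normalForm_IV` it is `3`. [cite: Tate1975, §7] [cite: Silverman1994, IV.9.4 Step 5] -/
theorem index_eq_three_of_IV_root [HenselianLocalRing R] (J : WeierstrassCurve R)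
    {ϖ α β γ δ ε : R} (hϖ : Irreducible ϖ) (hα : J.a₁ = ϖ * α) (hβ : J.a₂ = ϖ * β)
    (hγ : J.a₃ = ϖ * γ) (hδ : J.a₄ = ϖ ^ 2 * δ) (hε : J.a₆ = ϖ ^ 2 * ε)
    (hdisc : γ ^ 2 + 4 * ε ∉ maximalIdeal R) (hΔ : J.Δ ≠ 0) {y₀ : R}
    (hy₀ : y₀ ^ 2 + γ * y₀ - ε ∈ maximalIdeal R) :
    (J.nonsingularReductionSubgroup (integers_valuationRing_valuation R K)).index = 3 := by
  have hm : ϖ ∈ maximalIdeal R := (IsLocalRing.mem_maximalIdeal _).mpr hϖ.not_isUnit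
  obtain ⟨h1, h2, h3, h4, h6, hb₆⟩ := normalForm_IV_mem J hϖ hα hβ hγ hδ hε hdisc
  rcases index_mem_of_normalForm_IV (K := K) J h1 h2 h3 h4 h6 hb₆ with hidx | hidx
  swap
  · exact hidx
  exfalso
  obtain ⟨y, hy⟩ := exists_root_quadratic_of_henselian hdisc hy₀
  -- the point `(0, ϖ y)` of `E(K)`
  have hΔK : (J.baseChange K).Δ ≠ 0 := by
    rw [WeierstrassCurve.baseChange, map_Δ]
    exact (map_ne_zero_iff _ (IsFractionRing.injective R K)).mpr hΔ
  have heqR : J.toAffine.Equation 0 (ϖ * y) := by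
    rw [WeierstrassCurve.Affine.equation_iff]
    change (ϖ * y) ^ 2 + J.a₁ * 0 * (ϖ * y) + J.a₃ * (ϖ * y) = 0 ^ 3 + J.a₂ * 0 ^ 2 + J.a₄ * 0 + J.a₆
    rw [hγ, hε]
    linear_combination ϖ ^ 2 * hy
  have heq : (J.baseChange K).toAffine.Equation (algebraMap R K 0) (algebraMap R K (ϖ * y)) :=
    (WeierstrassCurve.Affine.map_equation _ (IsFractionRing.injective R K) _ _).mpr heqR
  have hns : (J.baseChange K).toAffine.Nonsingular (algebraMap R K 0) (algebraMap R K (ϖ * y)) :=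
    (WeierstrassCurve.Affine.equation_iff_nonsingular_of_Δ_ne_zero hΔK).mp heq
  have hbad : ¬ J.HasNonsingularReduction (.some _ _ hns) :=
    not_hasNonsingularReduction_some J h3 (Ideal.pow_le_self two_ne_zero h4) (Ideal.zero_mem _)
      (Ideal.mul_mem_right _ _ hm) hns
  rw [AddSubgroup.index_eq_one] at hidx
  have hmem : (WeierstrassCurve.Affine.Point.some _ _ hns) ∈
      J.nonsingularReductionSubgroup (integers_valuationRing_valuation R K) := hidx ▸ trivial
  exact hbad ((WeierstrassCurve.mem_nonsingularReductionSubgroup_iff _).mp hmem)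

/-! ### Type `IV*`: the same with `a₃ = π²γ`, `a₆ = π⁴ε` and the bad points `(π²x₂, π²y₂)` -/

/-- **Type `IV*`, no root ⟹ `[E(K) : E₀(K)] = 1`** (normal form `a₁ = πα`, `a₂ = π²β`, `a₃ = π²γ`,
`a₄ = π³δ`, `a₆ = π⁴ε`): a point with singular reduction is `(π²x₂, π²y₂)` with
`ȳ₂² + γ̄ȳ₂ − ε̄ = 0` (tree, `exists_eq_some_of_not_hasNonsingularReduction_IVstar`).
[cite: Silverman1994, IV.9.4 Step 8] -/
theorem index_eq_one_of_IVstar_no_root (J : WeierstrassCurve R) {ϖ α β γ δ ε : R}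
    (hϖ : Irreducible ϖ) (hα : J.a₁ = ϖ * α) (hβ : J.a₂ = ϖ ^ 2 * β) (hγ : J.a₃ = ϖ ^ 2 * γ)
    (hδ : J.a₄ = ϖ ^ 3 * δ) (hε : J.a₆ = ϖ ^ 4 * ε)
    (hno : ∀ y : ResidueField R, y ^ 2 + residue R γ * y - residue R ε ≠ 0) :
    (J.nonsingularReductionSubgroup (integers_valuationRing_valuation R K)).index = 1 := by
  have hres0 : residue R ϖ = 0 :=
    (residue_eq_zero_iff _).mpr ((IsLocalRing.mem_maximalIdeal _).mpr hϖ.not_isUnit)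
  rw [AddSubgroup.index_eq_one, eq_top_iff]
  intro P _
  refine (WeierstrassCurve.mem_nonsingularReductionSubgroup_iff _).mpr (not_not.mp fun hP => ?_)
  obtain ⟨x₂, y₂, h, -, hid⟩ :=
    exists_eq_some_of_not_hasNonsingularReduction_IVstar J hϖ hα hβ hγ hδ hε hP
  have := congrArg (residue R) hid
  exact hno (residue R y₂) (by simpa [hres0] using this)

/-- **Type `IV*`, a root ⟹ `[E(K) : E₀(K)] = 3`** (`R` Henselian, `π` the uniformizer): with
`γ² + 4ε ∉ 𝔪` the Step-8 quadratic `Y² + γ̄Y − ε̄` is separable (`quadraticStep8_eq`), an approximate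
root lifts to `y` with `y² + γy = ε`, and `(0, π²y) ∈ E(K) ∖ E₀(K)`; the tree's dichotomy
`index_mem_of_normalForm_IVstar` leaves `3`. [cite: Tate1975, §8] [cite: Silverman1994, IV.9.4 Step 8] -/
theorem index_eq_three_of_IVstar_root [HenselianLocalRing R] (J : WeierstrassCurve R)
    {α β γ δ ε : R} (hα : J.a₁ = uniformizer R * α) (hβ : J.a₂ = uniformizer R ^ 2 * β)
    (hγ : J.a₃ = uniformizer R ^ 2 * γ) (hδ : J.a₄ = uniformizer R ^ 3 * δ)
    (hε : J.a₆ = uniformizer R ^ 4 * ε) (hdisc : γ ^ 2 + 4 * ε ∉ maximalIdeal R) (hΔ : J.Δ ≠ 0)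
    {y₀ : R} (hy₀ : y₀ ^ 2 + γ * y₀ - ε ∈ maximalIdeal R) :
    (J.nonsingularReductionSubgroup (integers_valuationRing_valuation R K)).index = 3 := by
  set ϖ := uniformizer R with hϖdef
  have hϖ : Irreducible ϖ := irreducible_uniformizer
  have hm : ϖ ∈ maximalIdeal R := (IsLocalRing.mem_maximalIdeal _).mpr hϖ.not_isUnit
  have h1 : J.a₁ ∈ maximalIdeal R := hα ▸ Ideal.mul_mem_right _ _ hm
  have h2 : J.a₂ ∈ maximalIdeal R ^ 2 := hβ ▸ Ideal.mul_mem_right _ _ (Ideal.pow_mem_pow hm 2)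
  have h3 : J.a₃ ∈ maximalIdeal R ^ 2 := hγ ▸ Ideal.mul_mem_right _ _ (Ideal.pow_mem_pow hm 2)
  have h4 : J.a₄ ∈ maximalIdeal R ^ 3 := hδ ▸ Ideal.mul_mem_right _ _ (Ideal.pow_mem_pow hm 3)
  have h6 : J.a₆ ∈ maximalIdeal R ^ 4 := hε ▸ Ideal.mul_mem_right _ _ (Ideal.pow_mem_pow hm 4)
  have h8 : distinctRootCount (quadraticStep8 J) = 2 := by
    rw [quadraticStep8_eq hγ hε, TateAlgorithm.distinctRootCount_sq_add_sub_eq_two_iff]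
    intro h0
    apply hdisc
    rw [← residue_eq_zero_iff, map_add, map_mul, map_pow, map_ofNat]
    exact h0
  rcases index_mem_of_normalForm_IVstar (K := K) J h1 h2 h3 h4 h6 h8 with hidx | hidx
  swap
  · exact hidx
  exfalso
  obtain ⟨y, hy⟩ := exists_root_quadratic_of_henselian hdisc hy₀
  have hΔK : (J.baseChange K).Δ ≠ 0 := by
    rw [WeierstrassCurve.baseChange, map_Δ]
    exact (map_ne_zero_iff _ (IsFractionRing.injective R K)).mpr hΔ
  have heqR : J.toAffine.Equation 0 (ϖ ^ 2 * y) := by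
    rw [WeierstrassCurve.Affine.equation_iff]
    change (ϖ ^ 2 * y) ^ 2 + J.a₁ * 0 * (ϖ ^ 2 * y) + J.a₃ * (ϖ ^ 2 * y) =
      0 ^ 3 + J.a₂ * 0 ^ 2 + J.a₄ * 0 + J.a₆
    rw [hγ, hε]
    linear_combination ϖ ^ 4 * hy
  have heq : (J.baseChange K).toAffine.Equation (algebraMap R K 0)
      (algebraMap R K (ϖ ^ 2 * y)) :=
    (WeierstrassCurve.Affine.map_equation _ (IsFractionRing.injective R K) _ _).mpr heqR
  have hns : (J.baseChange K).toAffine.Nonsingular (algebraMap R K 0)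
      (algebraMap R K (ϖ ^ 2 * y)) :=
    (WeierstrassCurve.Affine.equation_iff_nonsingular_of_Δ_ne_zero hΔK).mp heq
  have hbad : ¬ J.HasNonsingularReduction (.some _ _ hns) :=
    not_hasNonsingularReduction_some J (Ideal.pow_le_self two_ne_zero h3)
      (Ideal.pow_le_self three_ne_zero h4) (Ideal.zero_mem _)
      (Ideal.mul_mem_right _ _ (Ideal.pow_le_self two_ne_zero (Ideal.pow_mem_pow hm 2))) hns
  rw [AddSubgroup.index_eq_one] at hidx
  have hmem : (WeierstrassCurve.Affine.Point.some _ _ hns) ∈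
      J.nonsingularReductionSubgroup (integers_valuationRing_valuation R K) := hidx ▸ trivial
  exact hbad ((WeierstrassCurve.mem_nonsingularReductionSubgroup_iff _).mp hmem)

end Local

/-! ### The same read on an integer equation cast into `R` along `p = ϖ ε` -/

section IntCast

open Tate

variable {R : Type*} [CommRing R] [IsDomain R] [IsDiscreteValuationRing R]
  {K : Type*} [Field K] [Algebra R K] [IsFractionRing R K] {p : ℕ} {ε : R}

/-- The value of `Y² + (ε̄ʲĀ) Y − ε̄²ʲ B̄` at `ε̄ʲ m̄` is `ε̄²ʲ (m² + A m − B)‾`. [folklore] -/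
theorem quadratic_residue_intCast (j : ℕ) (A B m : ℤ) :
    (residue R (m : R) * residue R ε ^ j) ^ 2 + residue R (ε ^ j * ((A : ℤ) : R)) *
        (residue R (m : R) * residue R ε ^ j) - residue R (ε ^ (2 * j) * ((B : ℤ) : R)) =
      (residue R ε ^ j) ^ 2 * residue R (((m ^ 2 + A * m - B : ℤ)) : R) := by
  push_cast
  simp only [map_add, map_sub, map_mul, map_pow, map_intCast]
  ring

/-- If every residue class of `R` is represented by an integer `m < p` (true for `ℤ_p`) and
`m² + A m − B ≢ 0 (mod p)` for every `m < p`, then `Y² + (ε̄ʲĀ) Y − ε̄²ʲB̄` has no root in the residue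
field. [folklore] -/
theorem no_root_of_forall_lt (hp : p.Prime) (hε : IsUnit ε) (hpε : (p : R) = uniformizer R * ε)
    (hsurj : ∀ y : ResidueField R, ∃ m : ℕ, m < p ∧ residue R ((m : ℤ) : R) = y) (j : ℕ) {A B : ℤ}
    (hno : ∀ m : ℕ, m < p → ¬ (p : ℤ) ∣ (m : ℤ) ^ 2 + A * m - B) (y : ResidueField R) :
    y ^ 2 + residue R (ε ^ j * ((A : ℤ) : R)) * y - residue R (ε ^ (2 * j) * ((B : ℤ) : R)) ≠ 0 := by
  have hē : residue R ε ^ j ≠ 0 := pow_ne_zero j (residue_ne_zero_of_isUnit hε)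
  intro hy
  obtain ⟨m, hmp, hm⟩ := hsurj (y * (residue R ε ^ j)⁻¹)
  have hy' : y = residue R ((m : ℤ) : R) * residue R ε ^ j := by rw [hm, inv_mul_cancel_right₀ hē]
  rw [hy', quadratic_residue_intCast] at hy
  exact mul_ne_zero (pow_ne_zero 2 hē) (residue_intCast_ne_zero hp hpε (hno m hmp)) hy

/-- **`IV` on an integer equation, no root ⟹ index `1`**: `p ∣ a₁, a₂, a₃`, `p² ∣ a₄, a₆`, every
residue class of `R` is represented by an integer `m < p` (true for `ℤ_p`), and
`m² + (a₃/p) m − a₆/p² ≢ 0 (p)` for all `m < p`. [cite: Silverman1994, IV.9.4 Step 5] -/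
theorem index_IV_intCast_eq_one (hp : p.Prime) (hε : IsUnit ε)
    (hpε : (p : R) = uniformizer R * ε) {M : WeierstrassCurve ℤ} (h1 : (p : ℤ) ^ 1 ∣ M.a₁)
    (h2 : (p : ℤ) ^ 1 ∣ M.a₂) (h3 : (p : ℤ) ^ 1 ∣ M.a₃) (h4 : (p : ℤ) ^ 2 ∣ M.a₄)
    (h6 : (p : ℤ) ^ 2 ∣ M.a₆)
    (hsurj : ∀ y : ResidueField R, ∃ m : ℕ, m < p ∧ residue R ((m : ℤ) : R) = y)
    (hno : ∀ m : ℕ, m < p →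
      ¬ (p : ℤ) ∣ (m : ℤ) ^ 2 + M.a₃ / (p : ℤ) ^ 1 * m - M.a₆ / (p : ℤ) ^ 2) :
    ((M.map (Int.castRingHom R)).nonsingularReductionSubgroup
      (integers_valuationRing_valuation R K)).index = 1 := by
  obtain ⟨e1, e2, e3, e4, e6, -⟩ := map_intCast_eqs (R := R) M
  exact index_eq_one_of_IV_no_root (K := K) _ irreducible_uniformizer
    (α := ε ^ 1 * ((M.a₁ / (p : ℤ) ^ 1 : ℤ) : R)) (β := ε ^ 1 * ((M.a₂ / (p : ℤ) ^ 1 : ℤ) : R))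
    (γ := ε ^ 1 * ((M.a₃ / (p : ℤ) ^ 1 : ℤ) : R)) (δ := ε ^ 2 * ((M.a₄ / (p : ℤ) ^ 2 : ℤ) : R))
    (ε := ε ^ (2 * 1) * ((M.a₆ / (p : ℤ) ^ 2 : ℤ) : R))
    (by rw [e1, intCast_eq_of_pow_dvd hpε h1, pow_one])
    (by rw [e2, intCast_eq_of_pow_dvd hpε h2, pow_one])
    (by rw [e3, intCast_eq_of_pow_dvd hpε h3, pow_one])
    (by rw [e4, intCast_eq_of_pow_dvd hpε h4]) (by rw [e6, intCast_eq_of_pow_dvd hpε h6])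
    (no_root_of_forall_lt hp hε hpε hsurj 1 hno)

/-- **`IV` on an integer equation, a root ⟹ index `3`** (`R` Henselian): `p ∣ a₁, a₂, a₃`,
`p² ∣ a₄, a₆`, `p ∤ (a₃/p)² + 4 (a₆/p²)`, `pⁿ ∥ Δ`, and an integer `m` with
`p ∣ m² + (a₃/p) m − a₆/p²`. [cite: Tate1975, §7] [cite: Silverman1994, IV.9.4 Step 5] -/
theorem index_IV_intCast_eq_three [HenselianLocalRing R] (hp : p.Prime) (hε : IsUnit ε)
    (hpε : (p : R) = uniformizer R * ε) {M : WeierstrassCurve ℤ} (h1 : (p : ℤ) ^ 1 ∣ M.a₁)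
    (h2 : (p : ℤ) ^ 1 ∣ M.a₂) (h3 : (p : ℤ) ^ 1 ∣ M.a₃) (h4 : (p : ℤ) ^ 2 ∣ M.a₄)
    (h6 : (p : ℤ) ^ 2 ∣ M.a₆)
    (hq : ¬ (p : ℤ) ∣ (M.a₃ / (p : ℤ) ^ 1) ^ 2 + 4 * (M.a₆ / (p : ℤ) ^ 2)) {n : ℕ}
    (hΔ : (p : ℤ) ^ n ∣ M.Δ) (hΔ' : ¬ (p : ℤ) ^ (n + 1) ∣ M.Δ) {m : ℤ}
    (hm : (p : ℤ) ∣ m ^ 2 + M.a₃ / (p : ℤ) ^ 1 * m - M.a₆ / (p : ℤ) ^ 2) :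
    ((M.map (Int.castRingHom R)).nonsingularReductionSubgroup
      (integers_valuationRing_valuation R K)).index = 3 := by
  obtain ⟨e1, e2, e3, e4, e6, eΔ⟩ := map_intCast_eqs (R := R) M
  refine index_eq_three_of_IV_root (K := K) _ irreducible_uniformizer
    (α := ε ^ 1 * ((M.a₁ / (p : ℤ) ^ 1 : ℤ) : R)) (β := ε ^ 1 * ((M.a₂ / (p : ℤ) ^ 1 : ℤ) : R))
    (γ := ε ^ 1 * ((M.a₃ / (p : ℤ) ^ 1 : ℤ) : R)) (δ := ε ^ 2 * ((M.a₄ / (p : ℤ) ^ 2 : ℤ) : R))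
    (ε := ε ^ 2 * ((M.a₆ / (p : ℤ) ^ 2 : ℤ) : R))
    (by rw [e1, intCast_eq_of_pow_dvd hpε h1, pow_one])
    (by rw [e2, intCast_eq_of_pow_dvd hpε h2, pow_one])
    (by rw [e3, intCast_eq_of_pow_dvd hpε h3, pow_one])
    (by rw [e4, intCast_eq_of_pow_dvd hpε h4]) (by rw [e6, intCast_eq_of_pow_dvd hpε h6]) ?_ ?_
    (y₀ := ε * (m : R)) ?_
  · have e : (ε ^ 1 * ((M.a₃ / (p : ℤ) ^ 1 : ℤ) : R)) ^ 2 +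
        4 * (ε ^ 2 * ((M.a₆ / (p : ℤ) ^ 2 : ℤ) : R)) =
        ε ^ 2 * (((M.a₃ / (p : ℤ) ^ 1) ^ 2 + 4 * (M.a₆ / (p : ℤ) ^ 2) : ℤ) : R) := by
      push_cast; ring
    rw [e]
    exact IsLocalRing.notMem_maximalIdeal.mpr ((hε.pow 2).mul (isUnit_intCast hp hpε hq))
  · rw [eΔ]
    exact fun h0 => not_pow_succ_dvd_intCast hp hε hpε hΔ hΔ' (h0 ▸ dvd_zero _)
  · have e : (ε * (m : R)) ^ 2 + ε ^ 1 * ((M.a₃ / (p : ℤ) ^ 1 : ℤ) : R) * (ε * (m : R)) -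
        ε ^ 2 * ((M.a₆ / (p : ℤ) ^ 2 : ℤ) : R) =
        ε ^ 2 * (((m ^ 2 + M.a₃ / (p : ℤ) ^ 1 * m - M.a₆ / (p : ℤ) ^ 2 : ℤ)) : R) := by
      push_cast; ring
    rw [e]
    exact Ideal.mul_mem_left _ _
      (mem_maximalIdeal_iff_dvd.mpr (uniformizer_dvd_intCast hpε (by simpa only [pow_one] using hm)))

/-- **`IV*` on an integer equation, no root ⟹ index `1`**: `p ∣ a₁`, `p² ∣ a₂, a₃`, `p³ ∣ a₄`,
`p⁴ ∣ a₆`, every residue class represented by an integer `m < p`, and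
`m² + (a₃/p²) m − a₆/p⁴ ≢ 0 (p)` for all `m < p`. [cite: Silverman1994, IV.9.4 Step 8] -/
theorem index_IVstar_intCast_eq_one (hp : p.Prime) (hε : IsUnit ε)
    (hpε : (p : R) = uniformizer R * ε) {M : WeierstrassCurve ℤ} (h1 : (p : ℤ) ^ 1 ∣ M.a₁)
    (h2 : (p : ℤ) ^ 2 ∣ M.a₂) (h3 : (p : ℤ) ^ 2 ∣ M.a₃) (h4 : (p : ℤ) ^ 3 ∣ M.a₄)
    (h6 : (p : ℤ) ^ 4 ∣ M.a₆)
    (hsurj : ∀ y : ResidueField R, ∃ m : ℕ, m < p ∧ residue R ((m : ℤ) : R) = y)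
    (hno : ∀ m : ℕ, m < p →
      ¬ (p : ℤ) ∣ (m : ℤ) ^ 2 + M.a₃ / (p : ℤ) ^ 2 * m - M.a₆ / (p : ℤ) ^ 4) :
    ((M.map (Int.castRingHom R)).nonsingularReductionSubgroup
      (integers_valuationRing_valuation R K)).index = 1 := by
  obtain ⟨e1, e2, e3, e4, e6, -⟩ := map_intCast_eqs (R := R) M
  exact index_eq_one_of_IVstar_no_root (K := K) _ irreducible_uniformizer
    (α := ε ^ 1 * ((M.a₁ / (p : ℤ) ^ 1 : ℤ) : R)) (β := ε ^ 2 * ((M.a₂ / (p : ℤ) ^ 2 : ℤ) : R))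
    (γ := ε ^ 2 * ((M.a₃ / (p : ℤ) ^ 2 : ℤ) : R)) (δ := ε ^ 3 * ((M.a₄ / (p : ℤ) ^ 3 : ℤ) : R))
    (ε := ε ^ (2 * 2) * ((M.a₆ / (p : ℤ) ^ 4 : ℤ) : R))
    (by rw [e1, intCast_eq_of_pow_dvd hpε h1, pow_one]) (by rw [e2, intCast_eq_of_pow_dvd hpε h2])
    (by rw [e3, intCast_eq_of_pow_dvd hpε h3]) (by rw [e4, intCast_eq_of_pow_dvd hpε h4])
    (by rw [e6, intCast_eq_of_pow_dvd hpε h6]) (no_root_of_forall_lt hp hε hpε hsurj 2 hno)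

/-- **`IV*` on an integer equation, a root ⟹ index `3`** (`R` Henselian): `p ∣ a₁`, `p² ∣ a₂, a₃`,
`p³ ∣ a₄`, `p⁴ ∣ a₆`, `p ∤ (a₃/p²)² + 4 (a₆/p⁴)`, `pⁿ ∥ Δ`, and an integer `m` with
`p ∣ m² + (a₃/p²) m − a₆/p⁴`. [cite: Tate1975, §8] [cite: Silverman1994, IV.9.4 Step 8] -/
theorem index_IVstar_intCast_eq_three [HenselianLocalRing R] (hp : p.Prime) (hε : IsUnit ε)
    (hpε : (p : R) = uniformizer R * ε) {M : WeierstrassCurve ℤ} (h1 : (p : ℤ) ^ 1 ∣ M.a₁)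
    (h2 : (p : ℤ) ^ 2 ∣ M.a₂) (h3 : (p : ℤ) ^ 2 ∣ M.a₃) (h4 : (p : ℤ) ^ 3 ∣ M.a₄)
    (h6 : (p : ℤ) ^ 4 ∣ M.a₆)
    (hq : ¬ (p : ℤ) ∣ (M.a₃ / (p : ℤ) ^ 2) ^ 2 + 4 * (M.a₆ / (p : ℤ) ^ 4)) {n : ℕ}
    (hΔ : (p : ℤ) ^ n ∣ M.Δ) (hΔ' : ¬ (p : ℤ) ^ (n + 1) ∣ M.Δ) {m : ℤ}
    (hm : (p : ℤ) ∣ m ^ 2 + M.a₃ / (p : ℤ) ^ 2 * m - M.a₆ / (p : ℤ) ^ 4) :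
    ((M.map (Int.castRingHom R)).nonsingularReductionSubgroup
      (integers_valuationRing_valuation R K)).index = 3 := by
  obtain ⟨e1, e2, e3, e4, e6, eΔ⟩ := map_intCast_eqs (R := R) M
  refine index_eq_three_of_IVstar_root (K := K) _
    (α := ε ^ 1 * ((M.a₁ / (p : ℤ) ^ 1 : ℤ) : R)) (β := ε ^ 2 * ((M.a₂ / (p : ℤ) ^ 2 : ℤ) : R))
    (γ := ε ^ 2 * ((M.a₃ / (p : ℤ) ^ 2 : ℤ) : R)) (δ := ε ^ 3 * ((M.a₄ / (p : ℤ) ^ 3 : ℤ) : R))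
    (ε := ε ^ 4 * ((M.a₆ / (p : ℤ) ^ 4 : ℤ) : R))
    (by rw [e1, intCast_eq_of_pow_dvd hpε h1, pow_one]) (by rw [e2, intCast_eq_of_pow_dvd hpε h2])
    (by rw [e3, intCast_eq_of_pow_dvd hpε h3]) (by rw [e4, intCast_eq_of_pow_dvd hpε h4])
    (by rw [e6, intCast_eq_of_pow_dvd hpε h6]) ?_ ?_ (y₀ := ε ^ 2 * (m : R)) ?_
  · have e : (ε ^ 2 * ((M.a₃ / (p : ℤ) ^ 2 : ℤ) : R)) ^ 2 +
        4 * (ε ^ 4 * ((M.a₆ / (p : ℤ) ^ 4 : ℤ) : R)) =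
        ε ^ 4 * (((M.a₃ / (p : ℤ) ^ 2) ^ 2 + 4 * (M.a₆ / (p : ℤ) ^ 4) : ℤ) : R) := by
      push_cast; ring
    rw [e]
    exact IsLocalRing.notMem_maximalIdeal.mpr ((hε.pow 4).mul (isUnit_intCast hp hpε hq))
  · rw [eΔ]
    exact fun h0 => not_pow_succ_dvd_intCast hp hε hpε hΔ hΔ' (h0 ▸ dvd_zero _)
  · have e : (ε ^ 2 * (m : R)) ^ 2 + ε ^ 2 * ((M.a₃ / (p : ℤ) ^ 2 : ℤ) : R) * (ε ^ 2 * (m : R)) -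
        ε ^ 4 * ((M.a₆ / (p : ℤ) ^ 4 : ℤ) : R) =
        ε ^ 4 * (((m ^ 2 + M.a₃ / (p : ℤ) ^ 2 * m - M.a₆ / (p : ℤ) ^ 4 : ℤ)) : R) := by
      push_cast; ring
    rw [e]
    exact Ideal.mul_mem_left _ _
      (mem_maximalIdeal_iff_dvd.mpr (uniformizer_dvd_intCast hpε (by simpa only [pow_one] using hm)))

end IntCast

end Summit.BirchSwinnertonDyer.BirchSwinnertonDyer.Rank2Observatory.Tam

end
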